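import Summits.ABC.ABC.Theses.CubicResolventAllowance
import Summits.ABC.ABC.Theorems.CubicResolventAllowanceResolventDiscBoundsCaps
import Literature.Algebra.Polynomial.RealCubicRoots
import Literature.NumberTheory.CubicFields.CubicFieldSignatureFromDiscriminant

/-!
# stub-ideation k2 (RESHAPE) — generation 5 sketch for `stub_complexCubic` (crux `IndexSzpiro`, stmt-ABC-22740)

Companion to `STUB-IDEAS-stub_complexCubic-2.md` (gen 5).  Two new typed entries on top of gens 1–4
(`StubIdeas2G4Sketch.lean` etc., same directory — NOT importable on the farm, so the three gen-4 decls the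
sandwich needs are re-declared VERBATIM in §R below):

* §N — the sign `d_K < 0` as a GALOIS/archimedean datum: one real root ⇒ `Gal(ψ_W) ≅ S₃`
  (`galS3_of_Δ_neg`, VERIFIED from N1a + N1b), `|Gal| = 6` (VERIFIED), and Brill in permutation form
  (`discr_neg_iff_sign_conjugate`, M): complex class ⟺ complex conjugation acts as a TRANSPOSITION on `Hom(K,ℂ)`.
* §A — the two-sided ALLOWANCE SANDWICH `oddRad ∣ d_K ∣ 1944·oddRad·addRad²` (`AllowanceDvd`, gen 4, M;
  `AllowanceExact`, NEW, M) and its VERIFIED consequence `AllowanceExact → IndexSzpiro → OddTowerSzpiroAdd`: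
  together with gen-4 `OddTowerSzpiro → AllowanceDvd → IndexSzpiro` the crux (hence the stub) is pinned between
  two `K`-FREE, SIGN-FREE Szpiro-type statements that differ only by `addRad² ∣ N`.

`lean check`: rc 0; sorries ONLY in helper bodies marked (S)/(M) below.
-/

open Polynomial

namespace Summit.ABC.ABC.Cruxes.IndexSzpiro.StubIdeas2G5

open Summit.ABC.ABC.Theses.CubicResolventAllowance (IndexSzpiro)

/-! ## §R  Verbatim re-declarations from gen 4 (`StubIdeas2G4Sketch.lean`, ns `…StubIdeas2G4`) -/

/-- (gen 4) the ODD-TOWER RADICAL: product of the primes at which `ord_p Δ_min` is odd. -/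
noncomputable def oddRadical (W : WeierstrassCurve ℚ) : ℕ :=
  ∏ p ∈ (W.minimalDiscriminantNorm ℤ).primeFactors.filter
      (fun p => Odd ((W.minimalDiscriminantNorm ℤ).factorization p)), p

theorem oddRadical_pos (W : WeierstrassCurve ℚ) : 0 < oddRadical W :=
  Finset.prod_pos fun _ hp => (Nat.prime_of_mem_primeFactors (Finset.mem_filter.mp hp).1).pos

/-- (gen 4) **K0 `OddTowerSzpiro`** — `K`-free, sign-free kernel (OPEN, Szpiro-strength). -/
def OddTowerSzpiro : Prop :=
  ∀ ε : ℝ, 0 < ε → ∃ C : ℝ, ∀ (W : WeierstrassCurve ℚ) [W.IsElliptic],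
    Irreducible W.twoTorsionPolynomial.toPoly →
    (W.minimalDiscriminantNorm ℤ : ℝ) ≤ C * (oddRadical W : ℝ) * (W.conductorNorm ℤ : ℝ) ^ (6 + ε)

/-- (gen 4) **R1 `AllowanceDvd`** (M): the odd-tower radical divides `d_K` (parity `ord_p Δ_min ≡ v_p(d_K) (2)`). -/
def AllowanceDvd : Prop :=
  ∀ (W : WeierstrassCurve ℚ) [W.IsElliptic] (K : Type) [Field K] [NumberField K],
    Irreducible W.twoTorsionPolynomial.toPoly → Module.finrank ℚ K = 3 →
    (∃ θ : K, aeval θ W.twoTorsionPolynomial.toPoly = 0) →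
    (oddRadical W : ℤ) ∣ NumberField.discr K

/-! ## §N  The sign as a Galois / archimedean datum (NEW) -/

attribute [local instance] Polynomial.Gal.splits_ℚ_ℂ

/-- **N1a (S, VERIFIED).** `ψ_W` irreducible ⇒ three distinct complex roots. -/
theorem card_rootSet_complex (W : WeierstrassCurve ℚ)
    (hirr : Irreducible W.twoTorsionPolynomial.toPoly) :
    Fintype.card (W.twoTorsionPolynomial.toPoly.rootSet ℂ) = 3 := by
  classical
  rw [Polynomial.card_rootSet_eq_natDegree hirr.separable (IsAlgClosed.splits _)]
  exact Cubic.natDegree_of_a_ne_zero (by norm_num [WeierstrassCurve.twoTorsionPolynomial])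

/-- **N1b (M).** `Δ(W) < 0` ⇒ exactly one real root (`twoTorsionPolynomial_discr : disc ψ = 16Δ`, `Cubic.map`,
tree `Literature.Algebra.Polynomial.card_roots_eq_one_of_discr_neg`, `rootSet_def`). -/
theorem card_rootSet_real_of_Δ_neg (W : WeierstrassCurve ℚ)
    (hirr : Irreducible W.twoTorsionPolynomial.toPoly) (hΔ : W.Δ < 0) :
    Fintype.card (W.twoTorsionPolynomial.toPoly.rootSet ℝ) = 1 := by
  sorry

/-- **N1 `galS3_of_Δ_neg` (S, VERIFIED from N1a/N1b + Mathlib `galActionHom_bijective_of_prime_degree`).**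
In the complex class (`Δ(W) < 0 ⟺ d_K < 0`, gen-4 H1′) the Galois group of `ψ_W` is the FULL `S₃`:
`ρ̄_{E,2}` is surjective; no cyclic-cubic resolvent fields occur in `stub_complexCubic`. -/
theorem galS3_of_Δ_neg (W : WeierstrassCurve ℚ)
    (hirr : Irreducible W.twoTorsionPolynomial.toPoly) (hΔ : W.Δ < 0) :
    Function.Bijective (Polynomial.Gal.galActionHom W.twoTorsionPolynomial.toPoly ℂ) := by
  refine Polynomial.Gal.galActionHom_bijective_of_prime_degree hirr ?_ ?_
  · rw [Cubic.natDegree_of_a_ne_zero (by norm_num [WeierstrassCurve.twoTorsionPolynomial])]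
    exact Nat.prime_three
  · rw [card_rootSet_complex W hirr, card_rootSet_real_of_Δ_neg W hirr hΔ]

/-- **N1c (S, VERIFIED).** Hence `|Gal(ψ_W)| = 6`, i.e. `[ℚ(E[2]) : ℚ] = 6` in the complex class. -/
theorem card_gal_eq_six (W : WeierstrassCurve ℚ)
    (hirr : Irreducible W.twoTorsionPolynomial.toPoly) (hΔ : W.Δ < 0) :
    Nat.card W.twoTorsionPolynomial.toPoly.Gal = 6 := by
  classical
  rw [Nat.card_eq_of_bijective _ (galS3_of_Δ_neg W hirr hΔ), Nat.card_eq_fintype_card,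
    Fintype.card_perm, card_rootSet_complex W hirr]
  rfl

open scoped Classical in
/-- **N2 `discr_neg_iff_sign_conjugate` (M; Brill `sign d_K = (−1)^{r₂}` in permutation form, any degree).**
`d_K < 0` iff complex conjugation, acting on `Hom(K,ℂ)` (cycle type `2^{r₂}1^{r₁}`), is an ODD permutation; for
`[K:ℚ] = 3`: iff it is a transposition.  This is the whole archimedean content of the stub's sign hypothesis
(the untyped corollary — the `S₃`-Artin lift of `ρ̄_{E,2}` is ODD, i.e. has a holomorphic weight-one companion of
level `|d_K|` — is recorded in the .md only: Mathlib has no Artin conductors / weight-one forms). -/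
theorem discr_neg_iff_sign_conjugate (K : Type) [Field K] [NumberField K] :
    NumberField.discr K < 0 ↔
      Equiv.Perm.sign (Function.Involutive.toPerm _
        (NumberField.ComplexEmbedding.involutive_conjugate K)) = -1 := by
  sorry

/-! ## §A  The allowance sandwich `oddRad ∣ d_K ∣ 1944 · oddRad · addRad²` (NEW upper half) -/

/-- The ADDITIVE RADICAL (primes `p ≥ 5` with conductor exponent `f_p = 2`). -/
noncomputable def addRadical (W : WeierstrassCurve ℚ) : ℕ :=
  ∏ p ∈ (W.conductorNorm ℤ).primeFactors.filter
      (fun p => 5 ≤ p ∧ (W.conductorNorm ℤ).factorization p = 2), p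

theorem addRadical_pos (W : WeierstrassCurve ℚ) : 0 < addRadical W :=
  Finset.prod_pos fun _ hp => (Nat.prime_of_mem_primeFactors (Finset.mem_filter.mp hp).1).pos

/-- (S, VERIFIED) `addRad² ∣ N` — by definition of the filter (`Finset.prod_dvd_of_coprime` over `ℤ`, `Nat.ordProj_dvd`). -/
theorem addRadical_sq_dvd_conductorNorm (W : WeierstrassCurve ℚ) [W.IsElliptic] :
    addRadical W ^ 2 ∣ W.conductorNorm ℤ := by
  classical
  unfold addRadical
  rw [← Finset.prod_pow, ← Int.natCast_dvd_natCast, Nat.cast_prod]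
  apply Finset.prod_dvd_of_coprime
  · intro p hp q hq hpq
    have hp' := Nat.prime_of_mem_primeFactors (Finset.mem_filter.mp hp).1
    have hq' := Nat.prime_of_mem_primeFactors (Finset.mem_filter.mp hq).1
    simp only [Function.onFun, Nat.cast_pow]
    exact (Nat.isCoprime_iff_coprime.mpr ((Nat.coprime_primes hp' hq').mpr hpq)).pow
  · intro p hp
    obtain ⟨hpN, -, h2⟩ := Finset.mem_filter.mp hp
    rw [Int.natCast_dvd_natCast, ← h2]
    exact Nat.ordProj_dvd _ _

/-- **S1⁺ `AllowanceExact` (M — the UPPER half of the sandwich; common refinement of k1 S1/S1♯ and gen-4 R1).**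
`|d_K| ∣ 2³·3⁵ · oddRad(W) · addRad(W)²`.  Local inputs: AE0 wild caps `v₂(d_K) ≤ 3`, `v₃(d_K) ≤ 5`
(tree `padicValNat_two_discr_le_three`, `padicValNat_three_discr_le_five`, PROVED) and the tame cap `v_p(d_K) ≤ 2`
for `p ≥ 5` (`padicValNat_discr_le_of_finrank_lt`, PROVED); AE1 parity; AE2 `f_p ≤ 1 ⇒ v_p(d_K) ≤ 1`. -/
def AllowanceExact : Prop :=
  ∀ (W : WeierstrassCurve ℚ) [W.IsElliptic] (K : Type) [Field K] [NumberField K],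
    Irreducible W.twoTorsionPolynomial.toPoly → Module.finrank ℚ K = 3 →
    (∃ θ : K, aeval θ W.twoTorsionPolynomial.toPoly = 0) →
    (NumberField.discr K).natAbs ∣ 1944 * oddRadical W * addRadical W ^ 2

/-- **AE1 (S modulo H1 `Δ(W) = q²·d_K`; = k3 L1 `ordMinDisc_parity` in factorization language).** -/
theorem factorization_parity (W : WeierstrassCurve ℚ) [W.IsElliptic] (K : Type) [Field K] [NumberField K]
    (hirr : Irreducible W.twoTorsionPolynomial.toPoly) (h3 : Module.finrank ℚ K = 3)
    (hθ : ∃ θ : K, aeval θ W.twoTorsionPolynomial.toPoly = 0) (p : ℕ) (hp : p.Prime) :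
    Even ((W.minimalDiscriminantNorm ℤ).factorization p + (NumberField.discr K).natAbs.factorization p) := by
  sorry

/-- **AE2 (M; = k1 `S1loc`).** At a prime `p ≥ 5` of good or multiplicative reduction the resolvent field is not
totally ramified: good ⇒ unramified (NOS, tree `not_dvd_discr_divisionField_two` for `ℚ(E[2]) ⊇ K`);
multiplicative ⇒ `ψ_W` splits over `ℚ_p^{nr}(√q)` (Tate curve; a quadratic twist does not move the roots' field),
so every `e(𝔓|p) ≤ 2 < 3`. [SilvermanAEC2009 VII.7.1, C.14; silverman1994 V.5] -/
theorem factorization_discr_le_one_of_conductor_le_one (W : WeierstrassCurve ℚ) [W.IsElliptic]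
    (K : Type) [Field K] [NumberField K]
    (hirr : Irreducible W.twoTorsionPolynomial.toPoly) (h3 : Module.finrank ℚ K = 3)
    (hθ : ∃ θ : K, aeval θ W.twoTorsionPolynomial.toPoly = 0)
    {p : ℕ} (hp : p.Prime) (h5 : 5 ≤ p) (hf : (W.conductorNorm ℤ).factorization p ≤ 1) :
    (NumberField.discr K).natAbs.factorization p ≤ 1 := by
  sorry

/-- **(S/M glue) AE0 + AE1 + AE2 ⇒ `AllowanceExact`**, prime by prime via `Nat.factorization_le_iff_dvd`:
`p = 2`: `≤ 3`; `p = 3`: `≤ 5`; `p ≥ 5`: `v_p(d_K) = 1 ⇒ p ∣ oddRad` (AE1), `= 2 ⇒ f_p = 2 ⇒ p² ∣ addRad²` (AE2,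
`f_p ≤ 2` for `p ≥ 5`), `≤ 2` always (tame cap). -/
theorem allowanceExact_of_local
    (hAE1 : ∀ (W : WeierstrassCurve ℚ) [W.IsElliptic] (K : Type) [Field K] [NumberField K],
      Irreducible W.twoTorsionPolynomial.toPoly → Module.finrank ℚ K = 3 →
      (∃ θ : K, aeval θ W.twoTorsionPolynomial.toPoly = 0) → ∀ p : ℕ, p.Prime →
      Even ((W.minimalDiscriminantNorm ℤ).factorization p + (NumberField.discr K).natAbs.factorization p))
    (hAE2 : ∀ (W : WeierstrassCurve ℚ) [W.IsElliptic] (K : Type) [Field K] [NumberField K],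
      Irreducible W.twoTorsionPolynomial.toPoly → Module.finrank ℚ K = 3 →
      (∃ θ : K, aeval θ W.twoTorsionPolynomial.toPoly = 0) → ∀ p : ℕ, p.Prime → 5 ≤ p →
      (W.conductorNorm ℤ).factorization p ≤ 1 → (NumberField.discr K).natAbs.factorization p ≤ 1) :
    AllowanceExact := by
  sorry

/-- **K0⁺ `OddTowerSzpiroAdd`** — the `K`-free, sign-free statement the crux IMPLIES (weaker than K0 exactly by
`addRad² ∣ N`; equal to K0 on curves with no additive prime `p ≥ 5`). OPEN, Szpiro-strength. -/
def OddTowerSzpiroAdd : Prop :=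
  ∀ ε : ℝ, 0 < ε → ∃ C : ℝ, ∀ (W : WeierstrassCurve ℚ) [W.IsElliptic],
    Irreducible W.twoTorsionPolynomial.toPoly →
    (W.minimalDiscriminantNorm ℤ : ℝ) ≤
      C * (oddRadical W : ℝ) * (addRadical W : ℝ) ^ 2 * (W.conductorNorm ℤ : ℝ) ^ (6 + ε)

/-- (S, VERIFIED) a resolvent field exists for every curve with irreducible `ψ_W`: `K := AdjoinRoot ψ_W`
(Mathlib `instance : NumberField (AdjoinRoot f)` under `Fact (Irreducible f)`, `AdjoinRoot.powerBasis_dim`,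
`Cubic.natDegree_of_a_ne_zero`; the `ℚ`-algebra structures agree by `Rat.algebra_rat_subsingleton`). -/
theorem exists_resolventField (W : WeierstrassCurve ℚ) (hirr : Irreducible W.twoTorsionPolynomial.toPoly) :
    ∃ (K : Type) (_ : Field K) (_ : NumberField K),
      Module.finrank ℚ K = 3 ∧ ∃ θ : K, aeval θ W.twoTorsionPolynomial.toPoly = 0 := by
  haveI : Fact (Irreducible W.twoTorsionPolynomial.toPoly) := ⟨hirr⟩
  have hdeg : W.twoTorsionPolynomial.toPoly.natDegree = 3 :=
    Cubic.natDegree_of_a_ne_zero (by norm_num [WeierstrassCurve.twoTorsionPolynomial])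
  have hfin : Module.finrank ℚ (AdjoinRoot W.twoTorsionPolynomial.toPoly) = 3 := by
    rw [(AdjoinRoot.powerBasis hirr.ne_zero).finrank, AdjoinRoot.powerBasis_dim, hdeg]
  have hroot := AdjoinRoot.aeval_eq (f := W.twoTorsionPolynomial.toPoly) W.twoTorsionPolynomial.toPoly
  rw [AdjoinRoot.mk_self] at hroot
  -- the `ℚ`-module / `ℚ`-algebra structure found by instance search on an abstract number field is the
  -- `Rat` one; transport along `Subsingleton (Module ℚ _)` / `Subsingleton (Algebra ℚ _)`.
  have keyfin : ∀ inst : Module ℚ (AdjoinRoot W.twoTorsionPolynomial.toPoly),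
      @Module.finrank ℚ (AdjoinRoot W.twoTorsionPolynomial.toPoly) _ _ inst = 3 := by
    intro inst
    obtain rfl := Subsingleton.elim inst
      (@Algebra.toModule _ _ _ _ (AdjoinRoot.instAlgebra W.twoTorsionPolynomial.toPoly))
    exact hfin
  have keyroot : ∀ inst : Algebra ℚ (AdjoinRoot W.twoTorsionPolynomial.toPoly),
      @aeval ℚ (AdjoinRoot W.twoTorsionPolynomial.toPoly) _ _ inst
        (AdjoinRoot.root W.twoTorsionPolynomial.toPoly) W.twoTorsionPolynomial.toPoly = 0 := by
    intro inst
    obtain rfl := Subsingleton.elim inst (AdjoinRoot.instAlgebra W.twoTorsionPolynomial.toPoly)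
    exact hroot
  exact ⟨AdjoinRoot W.twoTorsionPolynomial.toPoly, inferInstance, inferInstance, keyfin _,
    AdjoinRoot.root _, keyroot _⟩

/-- **VERIFIED: the crux implies the `K`-free statement K0⁺** (given the allowance lemma S1⁺). Read with gen-4
`IndexSzpiro_of' : OddTowerSzpiro → AllowanceDvd → IndexSzpiro`: `K0 ⇒ IndexSzpiro ⇒ K0⁺`, all `K`-free. -/
theorem oddTowerAdd_of_indexSzpiro (hA : AllowanceExact) (hI : IndexSzpiro) : OddTowerSzpiroAdd := by
  intro ε hε
  obtain ⟨C, hC⟩ := hI ε hε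
  refine ⟨max C 0 * 1944, fun W _ hirr => ?_⟩
  obtain ⟨K, _, _, h3, hθ⟩ := exists_resolventField W hirr
  have h1 := hC W K hirr h3 hθ
  have hdvd := hA W K hirr h3 hθ
  have hpos : 0 < 1944 * oddRadical W * addRadical W ^ 2 := by
    have := oddRadical_pos W
    have := addRadical_pos W
    positivity
  have hle : (NumberField.discr K).natAbs ≤ 1944 * oddRadical W * addRadical W ^ 2 :=
    Nat.le_of_dvd hpos hdvd
  have hleR : |(NumberField.discr K : ℝ)| ≤ ((1944 * oddRadical W * addRadical W ^ 2 : ℕ) : ℝ) := by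
    rw [← Int.cast_abs, Int.abs_eq_natAbs]
    exact_mod_cast hle
  have hN : 0 ≤ (W.conductorNorm ℤ : ℝ) ^ (6 + ε) := by positivity
  calc (W.minimalDiscriminantNorm ℤ : ℝ)
        ≤ C * |(NumberField.discr K : ℝ)| * (W.conductorNorm ℤ : ℝ) ^ (6 + ε) := h1
    _ ≤ max C 0 * |(NumberField.discr K : ℝ)| * (W.conductorNorm ℤ : ℝ) ^ (6 + ε) := by
        gcongr
        exact le_max_left _ _
    _ ≤ max C 0 * ((1944 * oddRadical W * addRadical W ^ 2 : ℕ) : ℝ) * (W.conductorNorm ℤ : ℝ) ^ (6 + ε) := by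
        gcongr
    _ = max C 0 * 1944 * (oddRadical W : ℝ) * (addRadical W : ℝ) ^ 2
          * (W.conductorNorm ℤ : ℝ) ^ (6 + ε) := by
        push_cast
        ring

end Summit.ABC.ABC.Cruxes.IndexSzpiro.StubIdeas2G5
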